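import Summits.RiemannHypothesis.RiemannHypothesis.Theorems.Splittings.LinearRayOnePointEvalTail
import Summits.RiemannHypothesis.RiemannHypothesis.Theorems.UniversalFactorMediumCover
import Summits.RiemannHypothesis.RiemannHypothesis.Theorems.UniversalFactorMediumYSums
import Summits.RiemannHypothesis.RiemannHypothesis.Theorems.UniversalFactorMediumKernelNoGoStubH0cosh

/-!
# Soundness of the one-point linear-ray check (cell rh-split, C15 / S-dbn-1)

`pointCheck_sound` — a passing `pointCheck` gives, for every `a` of the box `[A₁/AD, A₂/AD]`, the one-point
certificate inequality `(Re H_0(x))² < Q_a(x)(a Re H_0(x) − Re H_0′(x))` (the y-side enclosure of `Q_a` is the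
medium-kernel engine's `UniversalFactor.osaSide_bound`; the common scale `K = 2^sc` is divided out);
`linRayCheckWith_some` (the context is a VARIABLE: no closed context term is reduced by the kernel);
**`linRayCheck_sound`: a passing `linRayCheck pt A₁ A₂ AD sc` refutes the linear-factor ray for every
`a ∈ [A₁/AD, A₂/AD]`** (`LinearRayOnePoint.not_linearRay_of_onePoint`).
HONEST LABEL: machinery refuting an RH-STRENGTHENING conjunct (the linear-factor ray of
`Literature/Barriers/RiemannHypothesis/NewmanConjecture.lean`); RH-free; nothing here bears on the truth of RH.
Provenance: rh-splitx-eng-5 g3 (cell rh-split, D-0116 arm; C15 / S-dbn-1 filler → kernel), monolith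
`HOME/rh-splitx-eng-5/ray/LinearRayOnePointMono.lean`.
-/

set_option linter.dupNamespace false

noncomputable section

namespace Summit.RiemannHypothesis.RiemannHypothesis.Theorems.Splittings.LinearRayOnePoint

open MeasureTheory Set
open Literature.NumberTheory.LFunctions
open Literature.Analysis.ValidatedNumerics Literature.Analysis.ValidatedNumerics.NumericsMP
open Literature.Barriers.RiemannHypothesis (linearFactorH)
open Summit.RiemannHypothesis.RiemannHypothesis.Theorems

/-- **Soundness of the point check**: a passing point check gives, for every `a` of the box, the
one-point certificate inequality `(Re H_0(x))² < Q_a(x) · (a Re H_0(x) − Re H_0′(x))` at `x = xn/xd`. [folklore] -/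
theorem pointCheck_sound
    {C : UniversalFactor.OsaCtx} (hV : C.Valid) (pt : UniversalFactor.OsaPoint) (hok : pt.ok = true)
    {hx : MI} (hhx : MI.mem C.S (deBruijnH 0 ((((pt.xn : ℝ) / pt.xd : ℝ)) : ℂ)).re hx)
    {hpx : MI} (hhpx : MI.mem C.S (deriv (deBruijnH 0) ((((pt.xn : ℝ) / pt.xd : ℝ)) : ℂ)).re hpx)
    {valsF : Array MI}
    (hvF : ∀ i' < 32 * pt.CyF, MI.mem C.S (deBruijnH 0 ((((pt.xn : ℝ) / pt.xd + 1 *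
          ((2 * (i' / 32 : ℕ) + 1) * ((pt.rhoYn : ℝ) / pt.rhoYd) +
            (pt.rhoYn : ℝ) / pt.rhoYd * UniversalFactor.osaNodeR (i' % 32)) : ℝ)) : ℂ)).re
          (valsF.getD i' (MI.ofInt C.S 0)))
    {A₁ A₂ AD sc : ℕ} (hA : 0 < A₁) (hAD : 0 < AD)
    (hchk : pointCheck C pt hx hpx valsF A₁ A₂ AD sc = true)
    {a : ℝ} (ha1 : (A₁ : ℝ) / AD ≤ a) (ha2 : a ≤ (A₂ : ℝ) / AD) :
    (deBruijnH 0 ((((pt.xn : ℝ) / pt.xd : ℝ)) : ℂ)).re ^ 2 <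
      (∫ y in Ioi (0 : ℝ), deBruijnH 0 ((((pt.xn : ℝ) / pt.xd : ℝ) : ℂ) + y) * (Real.exp (-(a * y)) : ℂ)).re *
        (a * (deBruijnH 0 ((((pt.xn : ℝ) / pt.xd : ℝ)) : ℂ)).re - (deriv (deBruijnH 0) ((((pt.xn : ℝ) / pt.xd : ℝ)) : ℂ)).re) := by
  have hS := hV.hS
  have hSr : (0:ℝ) < C.S := by exact_mod_cast hS
  rw [UniversalFactor.osa_Q_eq]
  unfold pointCheck at hchk
  dsimp only at hchk
  split at hchk
  · rename_i WF eQ tQ hWF heQ htQ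
    have hQb := UniversalFactor.osaSide_bound UniversalFactor.stub_H0cosh hV pt hok (σ := 1) (by norm_num)
      hvF hA hAD ha1 ha2 hWF heQ htQ
    set Qs : MI := UniversalFactor.osaSideSum C pt valsF WF (32 * pt.CyF) 0 (MI.ofInt C.S 0) with hQsdef
    set Qr : ℝ := ∫ y in Ioi (0:ℝ), (deBruijnH 0 ((((pt.xn : ℝ) / pt.xd + 1 * y : ℝ)) : ℂ)).re * Real.exp (-(a * y)) with hQr
    simp only [decide_eq_true_eq] at hchk
    -- the enclosures of K Q, a, a K h − K h', (K h)²  (K = 2^sc)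
    set K : ℤ := 2 ^ sc with hK
    have hK0 : (0:ℝ) < (K : ℝ) := by rw [hK]; push_cast; positivity
    have hQmem : MI.mem C.S Qr ⟨Qs.lo - (eQ + tQ), Qs.hi + (eQ + tQ)⟩ := by
      constructor
      · have := hQb.1; push_cast; linarith
      · have := hQb.2; push_cast; linarith
    have hQK := MI.mem_mulInt hQmem K
    have hhK := MI.mem_mulInt hhx K
    have hhpK := MI.mem_mulInt hhpx K
    have hamem : MI.mem C.S a (MI.span (MI.ofFrac C.S (A₁ : ℤ) AD) (MI.ofFrac C.S (A₂ : ℤ) AD)) := by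
      have h1 := MI.mem_ofFrac C.S (A₁ : ℤ) hAD
      have h2 := MI.mem_ofFrac C.S (A₂ : ℤ) hAD
      push_cast at h1 h2
      exact MI.mem_span h1 h2 ha1 ha2
    have hT := MI.mem_sub (MI.mem_mul hS hamem hhK) hhpK
    have hrhs := MI.mem_mul hS hQK hT
    have hlhs := MI.mem_sqr hS hhK
    have hlt := MI.lt_of_hi_lt_lo hlhs hrhs hchk
    -- un-scale: (hK)² < (QK)(a hK − h'K) = K² · (Q(ah − h'))
    set h0 := (deBruijnH 0 ((((pt.xn : ℝ) / pt.xd : ℝ)) : ℂ)).re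
    set h1 := (deriv (deBruijnH 0) ((((pt.xn : ℝ) / pt.xd : ℝ)) : ℂ)).re
    have e : Qr * K * (a * (h0 * K) - h1 * K) - (h0 * K) ^ 2 = (K : ℝ) ^ 2 * (Qr * (a * h0 - h1) - h0 ^ 2) := by ring
    have hpos : 0 < (K : ℝ) ^ 2 * (Qr * (a * h0 - h1) - h0 ^ 2) := by rw [← e]; linarith
    have := pos_of_mul_pos_right hpos (by positivity)
    linarith
  · simp at hchk

/-- A passing parametrised check exposes its context and its data (the context is a variable here, so
no closed context term is ever reduced by the kernel). [folklore] -/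
theorem linRayCheckWith_some {oc : Option UniversalFactor.OsaCtx} {pt : UniversalFactor.OsaPoint} {A₁ A₂ AD sc : ℕ}
    (h : linRayCheckWith oc pt A₁ A₂ AD sc = true) :
    ∃ C, oc = some C ∧
      (0 < AD ∧ 0 < A₁ ∧ 0 < C.rhoUn ∧ 0 < C.rhoUd ∧ 0 < C.RUd ∧ 4 * C.RUn ≤ C.RUd ∧
        C.rhoUn * C.RUd < C.RUn * C.rhoUd ∧ 1 ≤ C.Nth ∧ C.phiTab.size = 32 * C.Cu) ∧
      pt.ok = true ∧
      ∃ hx hpx vF, UniversalFactor.osaH0 C pt.xn pt.xd = some hx ∧ evalH0D C pt.xn pt.xd = some hpx ∧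
        UniversalFactor.osaNodeVals C pt false (32 * pt.CyF) 0 #[] = some vF ∧
        pointCheck C pt hx hpx vF A₁ A₂ AD sc = true := by
  cases oc with
  | none => exact absurd h Bool.false_ne_true
  | some C =>
    refine ⟨C, rfl, ?_⟩
    simp only [linRayCheckWith, Bool.and_eq_true, decide_eq_true_eq] at h
    obtain ⟨⟨hcond, hok⟩, hdata⟩ := h
    refine ⟨hcond, hok, ?_⟩
    split at hdata
    · rename_i hx hpx vF hhx hhpx hvF
      exact ⟨hx, hpx, vF, hhx, hhpx, hvF, hdata⟩
    · exact absurd hdata Bool.false_ne_true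

/-- **Soundness of the one-point check**: if `linRayCheck pt A₁ A₂ AD sc` passes (context
`mkOsaCtx 256 90 64 20 3 400 1 10 64 6`), the linear-factor ray is refuted for every `a ∈ [A₁/AD, A₂/AD]`. [folklore] -/
theorem linRayCheck_sound {pt : UniversalFactor.OsaPoint} {A₁ A₂ AD sc : ℕ}
    (h : linRayCheck pt A₁ A₂ AD sc = true) {a : ℝ}
    (ha1 : (A₁ : ℝ) / AD ≤ a) (ha2 : a ≤ (A₂ : ℝ) / AD) :
    ¬ HasOnlyRealZeros (linearFactorH a) :=
  have hsome := linRayCheckWith_some h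
  hsome.elim fun C hC => by
    obtain ⟨hmk, ⟨hAD, hA, hrho, hrhod, hRd, hR4, hρR, hN, -⟩, hok, hx, hpx, vF, hhx, hhpx, hvF, hdata⟩ := hC
    have hV : C.Valid := UniversalFactor.valid_of_mkOsaCtx hmk (by norm_num) (by norm_num) (by norm_num)
      (by norm_num) (by norm_num) (by norm_num) (by norm_num)
    obtain ⟨hxd, hyn, hyd, -, -, -⟩ := (UniversalFactor.OsaPoint.ok_iff pt).1 hok
    have hhx' := UniversalFactor.mem_osaH0 hV hxd hhx
    have hhpx' := mem_evalH0D hV hxd hhpx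
    have hvF' := UniversalFactor.osaNodeVals_inv hV pt hxd hyd false (32 * pt.CyF) 0 #[] hvF rfl
      (fun i' hi' => absurd hi' (by omega))
    simp only [zero_add, Bool.false_eq_true, ↓reduceIte] at hvF'
    have hC := pointCheck_sound hV pt hok hhx' hhpx' hvF'.2 hA hAD hdata ha1 ha2
    have ha0 : 0 < a := lt_of_lt_of_le (by positivity) ha1
    exact not_linearRay_of_onePoint ha0 (by positivity) hC

end Summit.RiemannHypothesis.RiemannHypothesis.Theorems.Splittings.LinearRayOnePoint

end
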